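import Literature.NumberTheory.EllipticCurves.NeronLocalHeightGoodPlaces
import Literature.NumberTheory.EllipticCurves.NaiveHeightLocalDecomposition
import Literature.NumberTheory.EllipticCurves.HeightsProofs
import Mathlib.Algebra.Order.Ring.IsNonarchimedean
import HarnessLib

/-!
# The local decomposition of the canonical height over `ℚ` (ATAEC Thm. VI.2.1) — discharge

Topic `NumberTheory/EllipticCurves` (family `abc`, G06; also `bsd`). This file **discharges** the
named fact `WeierstrassCurve.Affine.Point.canonicalHeight_eq_two_mul_sum_neronLocalHeight` of
`NeronLocalHeight.lean` (Silverman, *Advanced Topics in the Arithmetic of Elliptic Curves*,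
Thm. VI.2.1, p. 461, over `K = ℚ`): for every rational point `P ≠ O` of an elliptic curve over `ℚ`
the Néron local heights `λ_p(P)` vanish for all but finitely many `p` and
`ĥ(P) = 2 (λ_∞(P) + Σ_p λ_p(P))` (`canonicalHeight_eq_two_mul_sum_neronLocalHeight_holds`; the
factor `2` is the normalisation of `canonicalHeight` in `Heights.lean`). With
`LangHeightSmallPointsProofs.lean` and `LangHeightNonarchEstimateProofs.lean` this removes the local
decomposition from the trust base of
`Literature.NumberTheory.EllipticCurves.szpiro_imp_langHeightLowerBoundConjecture`
(Hindry–Silverman 1988, Thm. 0.3), which now rests on Petsche's Lemma 3, the Kodaira–Néron facts of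
`KodairaNeron.lean` and the archimedean step `Petsche2006_exists_subset_le_neronLocalHeight_real`.

## Proof (ATAEC pp. 461–462, with two deviations)

Let `L(P) = λ_∞(P) + Σᶠ_p λ_p(P)` (Tate's `λᵥ = λ₁,ᵥ + μᵥ` of `NeronLocalHeight.lean`).

* *Finiteness* (`finite_support_neronLocalHeight_padicAbv`, Silverman's Lemma VI.2.2): outside the
  finite set of `p` with `log|2|_p, log|Δ|_p` or some `log|aᵢ|_p` non-zero
  (`finite_tateExceptional`), `λ_p = λ₁,p = ½ log⁺|x|_p` by `NeronLocalHeightGoodPlaces.lean`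
  (residue characteristic `2` is simply put into the exceptional set), and `λ₁,p(P) ≠ 0` only for
  `p ∣ den x(P)`.
* *`2L = h_x + O(1)`* (`exists_abs_two_mul_sum_neronLocalHeight_sub_naiveHeight_le`):
  `h_x = 2(λ₁,∞ + Σᶠ_p λ₁,p)` (`NaiveHeightLocalDecomposition.lean`), and `μᵥ` is bounded at every
  place by Tate's Lemma VI.1.2 (`NeronLocalHeightTateLemma.lean`) and zero off the exceptional set.
* *`L([2]P) = 4L(P)` for `[2]P ≠ O`* (`sum_neronLocalHeight_of_duplication`): the duplication
  formula ATAEC VI.1.1(iii) at every place (`neronLocalHeight_two_nsmul_of`) and the product formula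
  `log|t| + Σ_p log|t|_p = 0` for `t = 2y + a₁x + a₃` and `t = Δ`.
* *Points of order `2`* (`sum_neronLocalHeight_of_two_torsion`): Silverman uses the triplication
  formula (Ex. 6.4(e)); here instead Tate's series is summed in closed form for `[2]P = O`
  (`tateMu_of_two_nsmul_eq_zero`: `μ(P) = f(P)/4 + f(O)/12`), giving
  `λᵥ(P) = ⅛ log|φ₂(x(P))|ᵥ − (1/12) log|Δ|ᵥ` (`neronLocalHeight_of_two_torsion`, with `φ₂(x(P)) ≠ 0`
  by the Bézout identity), whence `L(P) = 0` by the product formula.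
* *Tate's uniqueness* (`eq_canonicalHeight_of_double`): a function `g` with `g = h_x + O(1)`,
  `g([2]P) = 4g(P)` for `[2]P ≠ O`, `g = 0` on points of order `2` and at `O` equals
  `ĥ = lim 4⁻ⁿ h_x(2ⁿP)` (`HeightsProofs.lean`): along `2ⁿP ≠ O` by the limit, and for `2`-power
  torsion both sides vanish.

## Design notes

* Pure proofs (`--kind proof`). Everything involving the group law (`[2]P`, `slope`) is proved in
  generic sections (any field, the classical `DecidableEq` used by `Heights.lean` and
  `NeronLocalHeight.lean`); the `ℚ`-specific summation lemmas take the doubled point abstractly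
  (`sum_neronLocalHeight_of_duplication`), so that no group-law term is re-elaborated with `ℚ`'s own
  decidable equality.

## References

* J. H. Silverman, *Advanced Topics in the Arithmetic of Elliptic Curves*, GTM 151 (1994),
  Thm. VI.1.1, Lemma VI.1.2, Prop. VI.1.3, Thm. VI.2.1 and Lemma VI.2.2 (pp. 454–462).
* J. H. Silverman, *The Arithmetic of Elliptic Curves*, 2nd ed. (2009), VIII.5.3 (product formula),
  VIII.9 (canonical height).
-/

noncomputable section

open scoped Classical

open Filter Topology

namespace WeierstrassCurve.Affine.Point

/-! ### Tate's uniqueness argument (ATAEC, end of the proof of Thm. VI.2.1) -/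

section Unique

variable {K : Type*} [Field K] [NumberField K] {W : WeierstrassCurve K} [W.IsElliptic]

/-- **Uniqueness of the canonical height** (Silverman, ATAEC, end of the proof of Thm. VI.2.1,
p. 462; AEC VIII.9.3): a function `g` on `E(K)` with `g = h_x + O(1)`, `g([2]P) = 4g(P)` whenever
`[2]P ≠ O`, `g(P) = 0` for the points of order `2`, and `g(O) = 0`, is the canonical height
(`ĥ = lim 4⁻ⁿ h_x(2ⁿP)`, normalisation of `Heights.lean`). [cite: Silverman1994, Thm VI.2.1] -/
theorem eq_canonicalHeight_of_double (g : W.toAffine.Point → ℝ)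
    (hbd : ∃ C : ℝ, ∀ P : W.toAffine.Point, |g P - naiveHeight P| ≤ C)
    (hdouble : ∀ P : W.toAffine.Point, (2 : ℕ) • P ≠ 0 → g ((2 : ℕ) • P) = 4 * g P)
    (htwo : ∀ P : W.toAffine.Point, P ≠ 0 → (2 : ℕ) • P = 0 → g P = 0) (h0 : g 0 = 0)
    (P : W.toAffine.Point) : g P = canonicalHeight P := by
  obtain ⟨C, hC⟩ := hbd
  by_cases htor : ∃ n : ℕ, (2 ^ n) • P = 0
  · -- `P` is `2`-power torsion: both sides vanish
    obtain ⟨n, hn⟩ := htor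
    have hfin : IsOfFinAddOrder P :=
      isOfFinAddOrder_iff_nsmul_eq_zero.mpr ⟨2 ^ n, pow_pos two_pos n, hn⟩
    rw [canonicalHeight_of_isOfFinAddOrder_holds hfin]
    -- descend to the first `k` with `2^k P = 0`
    induction n generalizing P with
    | zero =>
      rw [pow_zero, one_smul] at hn
      rw [hn, h0]
    | succ k ih =>
      by_cases hk : (2 ^ k) • P = 0
      · exact ih P hk (isOfFinAddOrder_iff_nsmul_eq_zero.mpr ⟨2 ^ k, pow_pos two_pos k, hk⟩)
      · -- `g(2^j P) = 4^j g(P)` for `j ≤ k`, and `2^k P` has order `2`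
        have hchain : ∀ j ≤ k, g ((2 ^ j) • P) = 4 ^ j * g P := by
          intro j hj
          induction j with
          | zero => simp
          | succ i ihi =>
            have hi : i ≤ k := Nat.le_of_succ_le hj
            have e : (2 ^ (i + 1)) • P = (2 : ℕ) • ((2 ^ i) • P) := by rw [pow_succ, mul_nsmul]
            have hne : (2 : ℕ) • ((2 ^ i) • P) ≠ 0 := by
              rw [← e]
              intro h
              apply hk
              have : (2 ^ k) • P = (2 ^ (k - (i + 1))) • ((2 ^ (i + 1)) • P) := by
                rw [← mul_nsmul, ← pow_add, Nat.add_sub_cancel' hj]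
              rw [this, h, smul_zero]
            rw [e, hdouble _ hne, ihi hi]
            ring
        have hQ : (2 ^ k) • P ≠ 0 := hk
        have hQ2 : (2 : ℕ) • ((2 ^ k) • P) = 0 := by rw [← mul_nsmul, ← pow_succ, hn]
        have := htwo _ hQ hQ2
        rw [hchain k le_rfl] at this
        have h4 : (4 : ℝ) ^ k ≠ 0 := pow_ne_zero _ (by norm_num)
        exact (mul_eq_zero.mp this).resolve_left h4
  · -- non-torsion along powers of `2`: Tate's limit
    push Not at htor
    have hchain : ∀ n : ℕ, g ((2 ^ n) • P) = 4 ^ n * g P := by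
      intro n
      induction n with
      | zero => simp
      | succ i ihi =>
        have e : (2 ^ (i + 1)) • P = (2 : ℕ) • ((2 ^ i) • P) := by rw [pow_succ, mul_nsmul]
        have hne : (2 : ℕ) • ((2 ^ i) • P) ≠ 0 := e ▸ htor (i + 1)
        rw [e, hdouble _ hne, ihi]
        ring
    have hlim : Tendsto (fun n : ℕ => naiveHeight ((2 ^ n) • P) / 4 ^ n) atTop (𝓝 (g P)) := by
      have heq : (fun n : ℕ => naiveHeight ((2 ^ n) • P) / 4 ^ n) =
          fun n : ℕ => g P + (naiveHeight ((2 ^ n) • P) - g ((2 ^ n) • P)) / 4 ^ n := by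
        funext n
        rw [hchain n]
        field_simp
        ring
      rw [heq]
      conv => arg 3; rw [show (𝓝 (g P)) = 𝓝 (g P + 0) by rw [add_zero]]
      refine tendsto_const_nhds.add ?_
      -- the error term is `≤ C / 4ⁿ → 0`
      have hgeom : Tendsto (fun n : ℕ => C / 4 ^ n) atTop (𝓝 0) := by
        have := (tendsto_pow_atTop_nhds_zero_of_lt_one (by norm_num : (0 : ℝ) ≤ 1 / 4)
          (by norm_num)).const_mul C
        simpa [div_eq_mul_inv, one_div, inv_pow] using this
      refine squeeze_zero_norm (fun n => ?_) hgeom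
      rw [Real.norm_eq_abs, abs_div, abs_of_pos (by positivity : (0 : ℝ) < 4 ^ n)]
      gcongr
      rw [abs_sub_comm]
      exact hC _
    exact tendsto_nhds_unique hlim (tendsto_canonicalHeight_holds P)

end Unique

/-! ### Points of order `2`: Tate's series and the local height in closed form -/

section TwoTorsion

variable {K : Type*} [Field K] (v : AbsoluteValue K ℝ) {W : WeierstrassCurve K}

/-- `[2]P ≠ O` iff `y(P) ≠ −y(P) − a₁x(P) − a₃` for an affine point `P`. [folklore] -/
theorem two_nsmul_some_ne_zero_iff {x y : K} (h : W.toAffine.Nonsingular x y) :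
    (2 : ℕ) • (some x y h) ≠ 0 ↔ y ≠ W.toAffine.negY x y := by
  constructor
  · intro h2 hy
    exact h2 (by rw [two_nsmul, add_self_of_Y_eq hy])
  · intro hy h2
    rw [two_nsmul, add_self_of_Y_ne hy] at h2
    exact WeierstrassCurve.Affine.Point.some_ne_zero _ h2

/-- `[2]P` in coordinates when `y(P) ≠ −y(P) − a₁x(P) − a₃` (Mathlib's `add_self_of_Y_ne`).
[folklore] -/
theorem two_nsmul_some_eq_of_Y_ne {x y : K} (h : W.toAffine.Nonsingular x y)
    (hy : y ≠ W.toAffine.negY x y) :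
    (2 : ℕ) • (some x y h) =
      some _ _ (WeierstrassCurve.Affine.nonsingular_add h h fun hxy => hy hxy.right) := by
  rw [two_nsmul, add_self_of_Y_ne hy]

/-- `[2]P ≠ O` forces `P ≠ O`. [folklore] -/
theorem ne_zero_of_two_nsmul_ne_zero {P : W.toAffine.Point} (h2 : (2 : ℕ) • P ≠ 0) : P ≠ 0 := by
  rintro rfl
  exact h2 (nsmul_zero _)

/-- For a point killed by `2`, Tate's series has two kinds of terms: `μ(P) = f(P)/4 + f(O)/12`
(the terms with `n ≥ 1` are `4^{-(n+1)} f(O)`). [folklore] -/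
theorem tateMu_of_two_nsmul_eq_zero [W.IsElliptic] (hf : tateCorrection_bounded v W)
    {P : W.toAffine.Point} (h2 : (2 : ℕ) • P = 0) :
    tateMu v P = tateCorrection v P / 4 + tateCorrection v (0 : W.toAffine.Point) / 12 := by
  have hs := summable_tateMu_of v hf P
  unfold tateMu
  rw [hs.tsum_eq_zero_add]
  have hvan : ∀ n : ℕ, (2 ^ (n + 1)) • P = 0 := fun n => by
    rw [pow_succ', mul_nsmul, h2, smul_zero]
  have htail : (fun n : ℕ => (1 / 4 : ℝ) ^ (n + 1 + 1) * tateCorrection v ((2 ^ (n + 1)) • P)) =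
      fun n : ℕ => tateCorrection v (0 : W.toAffine.Point) * (1 / 4) ^ 2 * (1 / 4 : ℝ) ^ n := by
    funext n
    rw [hvan n]
    ring
  rw [htail, tsum_mul_left, tsum_geometric_of_lt_one (by norm_num) (by norm_num), pow_zero, one_smul]
  ring

/-- **The Néron local height of a point of order `2` in closed form** (any absolute value,
characteristic `≠ 2`): if `y(P) = −y(P) − a₁x(P) − a₃` then `ψ₂²(x(P)) = 0`, `φ₂(x(P)) ≠ 0` and
`λᵥ(P) = ⅛ log|φ₂(x(P))|ᵥ − (1/12) log|Δ|ᵥ` (from Tate's series: `μ(P) = f(P)/4 + f(O)/12`).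
[folklore] -/
theorem neronLocalHeight_of_two_torsion [W.IsElliptic] (h2K : (2 : K) ≠ 0) {x y : K}
    (h : W.toAffine.Nonsingular x y) (hy : y = W.toAffine.negY x y) :
    (W.Φ 2).eval x ≠ 0 ∧
      neronLocalHeight v (some x y h) =
        1 / 8 * Real.log (v ((W.Φ 2).eval x)) - 1 / 12 * Real.log (v W.Δ) := by
  have hf := tateCorrection_bounded_of_two_ne_zero v W h2K
  have h2 : (2 : ℕ) • (some x y h) = 0 := by rw [two_nsmul, add_self_of_Y_eq hy]
  have hψ : W.Ψ₂Sq.eval x = 0 := by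
    have hyy : y - W.toAffine.negY x y = 0 := sub_eq_zero.mpr hy
    rw [← sub_negY_sq_eq_eval_Ψ₂Sq h.1, hyy, zero_pow two_ne_zero]
  have hφ : (W.Φ 2).eval x ≠ 0 := by
    intro hφ
    have hid := bezout_Φ_two_Ψ₂Sq W x
    simp only [hφ, hψ, mul_zero, add_zero] at hid
    have h64 : (64 : K) * W.Δ ^ 2 ≠ 0 := by
      refine mul_ne_zero ?_ (pow_ne_zero 2 W.isUnit_Δ.ne_zero)
      rw [show (64 : K) = 2 ^ 6 by norm_num]
      exact pow_ne_zero 6 h2K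
    exact h64 hid.symm
  refine ⟨hφ, ?_⟩
  have hφpos : 0 < v ((W.Φ 2).eval x) := v.pos hφ
  have hm : 0 < max (v x ^ 4) 1 := lt_max_of_lt_right one_pos
  have hmax : Real.log (max (v x ^ 4) 1) = 4 * Real.log (max 1 (v x)) := by
    have hc4 : max (v x ^ 4) 1 = (max 1 (v x)) ^ 4 := by
      rcases le_total (v x) 1 with h1 | h1
      · rw [max_eq_left h1, one_pow, max_eq_right (pow_le_one₀ (v.nonneg x) h1)]
      · rw [max_eq_right h1, max_eq_left (one_le_pow₀ h1)]
    rw [hc4, Real.log_pow]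
    norm_num
  rw [neronLocalHeight, tateMu_of_two_nsmul_eq_zero v hf h2, naiveLocalHeight_some,
    tateCorrection_some, tateCorrection_zero, hψ, v.map_zero, max_eq_left hφpos.le,
    Real.log_div hφpos.ne' hm.ne', hmax, Real.posLog_eq_log_max_one (v.nonneg x)]
  ring

end TwoTorsion

/-! ### The decomposition over `ℚ` -/

section Rat

open IsDedekindDomain Rat.HeightOneSpectrum Literature.NumberTheory.EllipticCurves

variable {W : WeierstrassCurve ℚ}

/-- The `p`-adic absolute values of `ℚ` are nonarchimedean. [folklore] -/
theorem isNonarchimedean_padicAbv (v : HeightOneSpectrum ℤ) : IsNonarchimedean (padicAbv v) := by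
  intro a b
  simp only [padicAbv_apply]
  haveI : Fact (natGenerator v).Prime := ⟨prime_natGenerator v⟩
  exact_mod_cast padicNorm.nonarchimedean

/-- The support of `v ↦ log |r|_v` is finite for every rational `r` (empty for `r = 0`).
[folklore] -/
theorem finite_support_log_padicAbv' (r : ℚ) :
    (Function.support fun v : HeightOneSpectrum ℤ => Real.log (padicAbv v r)).Finite := by
  by_cases hr : r = 0
  · subst hr
    simp
  · exact Rat.finite_support_log_padicAbv hr

/-- If `log |r|_v = 0` then `|r|_v ≤ 1`, and `|r|_v = 1` when `r ≠ 0`. [folklore] -/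
theorem padicAbv_of_log_eq_zero {r : ℚ} {v : HeightOneSpectrum ℤ} (h : Real.log (padicAbv v r) = 0) :
    padicAbv v r ≤ 1 ∧ (r ≠ 0 → padicAbv v r = 1) := by
  rcases Real.log_eq_zero.mp h with h0 | h1 | hm1
  · refine ⟨by rw [h0]; exact zero_le_one, fun hr => ?_⟩
    exact absurd ((padicAbv v).eq_zero.mp h0) hr
  · exact ⟨h1.le, fun _ => h1⟩
  · exact absurd hm1 (by linarith [(padicAbv v).nonneg r])

variable (W) in
/-- The finitely many `p`-adic places at which Tate's correction term of `W / ℚ` need not vanish: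
those where one of `log|2|_v, log|Δ|_v, log|aᵢ|_v` is non-zero. [folklore] -/
theorem finite_tateExceptional :
    {v : HeightOneSpectrum ℤ | ¬ (Real.log (padicAbv v 2) = 0 ∧ Real.log (padicAbv v W.Δ) = 0 ∧
      Real.log (padicAbv v W.a₁) = 0 ∧ Real.log (padicAbv v W.a₂) = 0 ∧
      Real.log (padicAbv v W.a₃) = 0 ∧ Real.log (padicAbv v W.a₄) = 0 ∧
      Real.log (padicAbv v W.a₆) = 0)}.Finite := by
  refine Set.Finite.subset (((((((finite_support_log_padicAbv' 2).union
    (finite_support_log_padicAbv' W.Δ)).union (finite_support_log_padicAbv' W.a₁)).union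
    (finite_support_log_padicAbv' W.a₂)).union (finite_support_log_padicAbv' W.a₃)).union
    (finite_support_log_padicAbv' W.a₄)).union (finite_support_log_padicAbv' W.a₆)) ?_
  intro v hv
  simp only [Set.mem_setOf_eq, not_and_or] at hv
  simp only [Set.mem_union, Function.mem_support]
  tauto

/-- Outside the exceptional set, the Néron local height is the naive one (`NeronLocalHeightGoodPlaces`).
[folklore] -/
theorem neronLocalHeight_padicAbv_eq_naive_of_good {v : HeightOneSpectrum ℤ}
    (hv : Real.log (padicAbv v 2) = 0 ∧ Real.log (padicAbv v W.Δ) = 0 ∧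
      Real.log (padicAbv v W.a₁) = 0 ∧ Real.log (padicAbv v W.a₂) = 0 ∧
      Real.log (padicAbv v W.a₃) = 0 ∧ Real.log (padicAbv v W.a₄) = 0 ∧
      Real.log (padicAbv v W.a₆) = 0) [W.IsElliptic]
    (P : W.toAffine.Point) : neronLocalHeight (padicAbv v) P = naiveLocalHeight (padicAbv v) P := by
  obtain ⟨h2, hΔ, h₁, h₂, h₃, h₄, h₆⟩ := hv
  exact neronLocalHeight_eq_naiveLocalHeight_of_good (isNonarchimedean_padicAbv v)
    (padicAbv_of_log_eq_zero h₁).1 (padicAbv_of_log_eq_zero h₂).1 (padicAbv_of_log_eq_zero h₃).1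
    (padicAbv_of_log_eq_zero h₄).1 (padicAbv_of_log_eq_zero h₆).1
    ((padicAbv_of_log_eq_zero hΔ).2 W.isUnit_Δ.ne_zero) ((padicAbv_of_log_eq_zero h2).2 two_ne_zero) P

variable [W.IsElliptic]

/-- The Néron local heights `λ_v(P)`, `v` finite, of a rational point vanish for all but finitely
many `v` (ATAEC, proof of Thm. VI.2.1: "the sum has only finitely many non-zero terms").
[cite: Silverman1994, Thm VI.2.1] -/
theorem finite_support_neronLocalHeight_padicAbv (P : W.toAffine.Point) :
    (Function.support fun v : HeightOneSpectrum ℤ => neronLocalHeight (padicAbv v) P).Finite := by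
  refine Set.Finite.subset ((finite_tateExceptional W).union
    (Point.finite_support_naiveLocalHeight_padicAbv P)) fun v hv => ?_
  rw [Function.mem_support] at hv
  by_cases hgood : Real.log (padicAbv v 2) = 0 ∧ Real.log (padicAbv v W.Δ) = 0 ∧
      Real.log (padicAbv v W.a₁) = 0 ∧ Real.log (padicAbv v W.a₂) = 0 ∧
      Real.log (padicAbv v W.a₃) = 0 ∧ Real.log (padicAbv v W.a₄) = 0 ∧
      Real.log (padicAbv v W.a₆) = 0
  · right
    rw [Function.mem_support, ← neronLocalHeight_padicAbv_eq_naive_of_good hgood P]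
    exact hv
  · left
    exact hgood

/-- `μ_v(P) = λ_v(P) − λ₁,v(P)` vanishes outside the exceptional set, so it is finitely supported in
`v`. [folklore] -/
theorem finite_support_tateMu_padicAbv (P : W.toAffine.Point) :
    (Function.support fun v : HeightOneSpectrum ℤ => tateMu (padicAbv v) P).Finite := by
  refine Set.Finite.subset (finite_tateExceptional W) fun v hv => ?_
  rw [Function.mem_support] at hv
  intro hgood
  apply hv
  have := neronLocalHeight_padicAbv_eq_naive_of_good hgood P
  rw [neronLocalHeight] at this
  linarith

/-! #### `L = ½ h_x + O(1)` -/

/-- The boundedness `|2 Σ_v λ_v(P) − h_x(P)| ≤ C` over `ℚ` (ATAEC, proof of Thm. VI.2.1: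
`L(P) = ½ h(x(P)) + O(1)`), from Tate's Lemma VI.1.2 at the real place and at the finitely many
exceptional `p`-adic places, and `λ_v = λ₁,v` elsewhere. [cite: Silverman1994, Thm VI.2.1] -/
theorem exists_abs_two_mul_sum_neronLocalHeight_sub_naiveHeight_le :
    ∃ C : ℝ, ∀ P : W.toAffine.Point,
      |2 * (neronLocalHeight Rat.AbsoluteValue.real P +
          ∑ᶠ v : HeightOneSpectrum ℤ, neronLocalHeight (padicAbv v) P) - naiveHeight P| ≤ C := by
  -- Tate's lemma at every place
  have hreal : ∃ C, ∀ P : W.toAffine.Point, |tateCorrection Rat.AbsoluteValue.real P| ≤ C :=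
    tateCorrection_bounded_of_two_ne_zero Rat.AbsoluteValue.real W two_ne_zero
  have hpadic : ∀ v : HeightOneSpectrum ℤ, ∃ C, ∀ P : W.toAffine.Point,
      |tateCorrection (padicAbv v) P| ≤ C := fun v =>
    tateCorrection_bounded_of_two_ne_zero (padicAbv v) W two_ne_zero
  choose Cp hCp using hpadic
  obtain ⟨Cinf, hCinf⟩ := hreal
  set S := (finite_tateExceptional W).toFinset with hS
  refine ⟨2 * (Cinf / 3 + ∑ v ∈ S, Cp v / 3), fun P => ?_⟩
  -- `2 Σ λ − h = 2 (μ_∞ + Σᶠ μ_v)`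
  have hfinμ := finite_support_tateMu_padicAbv P
  have hfinl1 := Point.finite_support_naiveLocalHeight_padicAbv P
  have hdecomp : neronLocalHeight Rat.AbsoluteValue.real P +
        ∑ᶠ v : HeightOneSpectrum ℤ, neronLocalHeight (padicAbv v) P =
      (naiveLocalHeight Rat.AbsoluteValue.real P +
          ∑ᶠ v : HeightOneSpectrum ℤ, naiveLocalHeight (padicAbv v) P) +
        (tateMu Rat.AbsoluteValue.real P + ∑ᶠ v : HeightOneSpectrum ℤ, tateMu (padicAbv v) P) := by
    simp only [neronLocalHeight]
    rw [finsum_add_distrib hfinl1 hfinμ]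
    ring
  rw [hdecomp, Point.naiveHeight_eq_two_mul P]
  have hμS : ∑ᶠ v : HeightOneSpectrum ℤ, tateMu (padicAbv v) P = ∑ v ∈ S, tateMu (padicAbv v) P := by
    apply finsum_eq_sum_of_support_subset
    intro v hv
    rw [hS, Set.Finite.coe_toFinset]
    intro hgood
    rw [Function.mem_support] at hv
    apply hv
    have := neronLocalHeight_padicAbv_eq_naive_of_good hgood P
    rw [neronLocalHeight] at this
    linarith
  rw [hμS]
  have hinf : |tateMu Rat.AbsoluteValue.real P| ≤ Cinf / 3 := abs_tateMu_le_of _ hCinf P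
  have hp : ∀ v, |tateMu (padicAbv v) P| ≤ Cp v / 3 := fun v => abs_tateMu_le_of _ (hCp v) P
  have hsum : |∑ v ∈ S, tateMu (padicAbv v) P| ≤ ∑ v ∈ S, Cp v / 3 :=
    (Finset.abs_sum_le_sum_abs _ _).trans (Finset.sum_le_sum fun v _ => hp v)
  rw [show 2 * (naiveLocalHeight Rat.AbsoluteValue.real P +
        ∑ᶠ v : HeightOneSpectrum ℤ, naiveLocalHeight (padicAbv v) P +
      (tateMu Rat.AbsoluteValue.real P + ∑ v ∈ S, tateMu (padicAbv v) P)) -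
      2 * (naiveLocalHeight Rat.AbsoluteValue.real P +
        ∑ᶠ v : HeightOneSpectrum ℤ, naiveLocalHeight (padicAbv v) P) =
      2 * (tateMu Rat.AbsoluteValue.real P + ∑ v ∈ S, tateMu (padicAbv v) P) by ring]
  rw [abs_mul, abs_two]
  gcongr
  exact (abs_add_le _ _).trans (add_le_add hinf hsum)

/-! #### `L([2]P) = 4L(P)` -/

/-- The real absolute value of `ℚ` as `|·|` on `ℝ`. [folklore] -/
theorem real_apply (r : ℚ) : Rat.AbsoluteValue.real r = |(r : ℝ)| := by
  rw [Rat.AbsoluteValue.real_eq_abs, Rat.cast_abs]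

/-- The doubling relation `Σ_v λ_v([2]P) = 4 Σ_v λ_v(P)` over `ℚ` (ATAEC, proof of Thm. VI.2.1:
the duplication formula VI.1.1(iii) at every place — hypothesis `hdup`, for the point `(x₂, y₂) = [2]P` —
and the product formula for `2y + a₁x + a₃ ≠ 0` and `Δ`). [cite: Silverman1994, Thm VI.2.1] -/
theorem sum_neronLocalHeight_of_duplication {x y : ℚ} (h : W.toAffine.Nonsingular x y)
    (hy : y ≠ W.toAffine.negY x y) {x₂ y₂ : ℚ} (h₂ : W.toAffine.Nonsingular x₂ y₂)
    (hdup : ∀ v : AbsoluteValue ℚ ℝ, neronLocalHeight v (some x₂ y₂ h₂) =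
      4 * neronLocalHeight v (some x y h) - Real.log (v (2 * y + W.a₁ * x + W.a₃)) +
        1 / 4 * Real.log (v W.Δ)) :
    neronLocalHeight Rat.AbsoluteValue.real (some x₂ y₂ h₂) +
        ∑ᶠ v : HeightOneSpectrum ℤ, neronLocalHeight (padicAbv v) (some x₂ y₂ h₂) =
      4 * (neronLocalHeight Rat.AbsoluteValue.real (some x y h) +
        ∑ᶠ v : HeightOneSpectrum ℤ, neronLocalHeight (padicAbv v) (some x y h)) := by
  set t : ℚ := 2 * y + W.a₁ * x + W.a₃ with ht
  have ht0 : t ≠ 0 := by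
    intro h0
    apply hy
    simp only [WeierstrassCurve.Affine.negY]
    linarith
  have hfinl := finite_support_neronLocalHeight_padicAbv (some x y h)
  have hfint := Rat.finite_support_log_padicAbv ht0
  have hfinΔ := Rat.finite_support_log_padicAbv W.isUnit_Δ.ne_zero
  have hpt := Rat.log_abs_add_finsum_log_padicAbv ht0
  have hpΔ := Rat.log_abs_add_finsum_log_padicAbv W.isUnit_Δ.ne_zero
  simp_rw [hdup]
  have hfin4 : (Function.support fun v : HeightOneSpectrum ℤ =>
      4 * neronLocalHeight (padicAbv v) (some x y h)).Finite :=
    hfinl.subset fun v hv => by simpa [Function.mem_support] using hv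
  have hfin4t : (Function.support fun v : HeightOneSpectrum ℤ =>
      4 * neronLocalHeight (padicAbv v) (some x y h) - Real.log (padicAbv v t)).Finite := by
    refine (hfin4.union hfint).subset fun v hv => ?_
    rw [Function.mem_support] at hv
    by_contra hcon
    simp only [Set.mem_union, Function.mem_support, not_or, not_not] at hcon
    exact hv (by rw [hcon.1, hcon.2, sub_zero])
  have hfinΔ4 : (Function.support fun v : HeightOneSpectrum ℤ =>
      1 / 4 * Real.log (padicAbv v W.Δ)).Finite :=
    hfinΔ.subset fun v hv => by simpa [Function.mem_support] using hv
  rw [finsum_add_distrib hfin4t hfinΔ4, finsum_sub_distrib hfin4 hfint, ← mul_finsum, ← mul_finsum,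
    real_apply, real_apply]
  linarith

/-! #### Points of order `2` -/

/-- For a rational point of order `2`, `Σ_v λ_v(P) = 0` (product formula applied to `φ₂(x(P))` and
`Δ`, using `neronLocalHeight_of_two_torsion`); this replaces the triplication-formula argument of
ATAEC (proof of Thm. VI.2.1, p. 462). [cite: Silverman1994, Thm VI.2.1] -/
theorem sum_neronLocalHeight_of_two_torsion {x y : ℚ} (h : W.toAffine.Nonsingular x y)
    (hy : y = W.toAffine.negY x y) :
    neronLocalHeight Rat.AbsoluteValue.real (some x y h) +
        ∑ᶠ v : HeightOneSpectrum ℤ, neronLocalHeight (padicAbv v) (some x y h) = 0 := by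
  have hφ := (neronLocalHeight_of_two_torsion Rat.AbsoluteValue.real two_ne_zero h hy).1
  have hform : ∀ v : AbsoluteValue ℚ ℝ, neronLocalHeight v (some x y h) =
      1 / 8 * Real.log (v ((W.Φ 2).eval x)) - 1 / 12 * Real.log (v W.Δ) :=
    fun v => (neronLocalHeight_of_two_torsion v two_ne_zero h hy).2
  have hfinφ := Rat.finite_support_log_padicAbv hφ
  have hfinΔ := Rat.finite_support_log_padicAbv W.isUnit_Δ.ne_zero
  have hpφ := Rat.log_abs_add_finsum_log_padicAbv hφ
  have hpΔ := Rat.log_abs_add_finsum_log_padicAbv W.isUnit_Δ.ne_zero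
  simp_rw [hform]
  have hfin1 : (Function.support fun v : HeightOneSpectrum ℤ =>
      1 / 8 * Real.log (padicAbv v ((W.Φ 2).eval x))).Finite :=
    hfinφ.subset fun v hv => by simpa [Function.mem_support] using hv
  have hfin2 : (Function.support fun v : HeightOneSpectrum ℤ =>
      1 / 12 * Real.log (padicAbv v W.Δ)).Finite :=
    hfinΔ.subset fun v hv => by simpa [Function.mem_support] using hv
  rw [finsum_sub_distrib hfin1 hfin2, ← mul_finsum, ← mul_finsum, real_apply, real_apply]
  linarith

/-! #### The discharge -/

variable (W) in
omit [W.IsElliptic] in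
/-- **Discharge of `canonicalHeight_eq_two_mul_sum_neronLocalHeight`** (Silverman, ATAEC
Thm. VI.2.1 over `ℚ`): for every rational point `P ≠ O` of an elliptic curve over `ℚ`,
`ĥ(P) = 2 (λ_∞(P) + Σ_p λ_p(P))`, the sum being finite. Printed proof (pp. 461–462), followed here:
`L(P) = Σ_v λ_v(P)` is well defined (`finite_support_neronLocalHeight_padicAbv`, via Lemma VI.2.2 =
`NeronLocalHeightGoodPlaces`), `L = ½h_x + O(1)` (Thm. VI.1.1(i),(ii) = Tate's Lemma VI.1.2,
`NeronLocalHeightTateLemma`), `L([2]P) = 4L(P)` (Thm. VI.1.1(iii) and the product formula), and for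
the points of order `2` — where Silverman uses the triplication formula — `L(P) = 0` directly from
Tate's series and the product formula; Tate's uniqueness argument (`eq_canonicalHeight_of_double`)
then gives `ĥ = 2L` in the normalisation of `Heights.lean`. [cite: Silverman1994, Thm VI.2.1] -/
theorem canonicalHeight_eq_two_mul_sum_neronLocalHeight_holds :
    canonicalHeight_eq_two_mul_sum_neronLocalHeight W := by
  intro _ P hP
  refine ⟨finite_support_neronLocalHeight_padicAbv P, ?_⟩
  -- the candidate `g`
  set L : W.toAffine.Point → ℝ := fun Q => neronLocalHeight Rat.AbsoluteValue.real Q +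
    ∑ᶠ v : HeightOneSpectrum ℤ, neronLocalHeight (padicAbv v) Q with hL
  set g : W.toAffine.Point → ℝ := fun Q => if Q = 0 then 0 else 2 * L Q with hg
  have hgP : g P = 2 * L P := by rw [hg]; simp [hP]
  suffices hmain : ∀ Q, g Q = canonicalHeight Q by
    rw [← hmain P, hgP]
  refine eq_canonicalHeight_of_double g ?_ ?_ ?_ (by rw [hg]; simp)
  · -- bounded difference
    obtain ⟨C, hC⟩ := exists_abs_two_mul_sum_neronLocalHeight_sub_naiveHeight_le (W := W)
    refine ⟨max C 0, fun Q => ?_⟩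
    by_cases hQ : Q = 0
    · subst hQ
      rw [hg]
      simp
    · rw [hg]
      simp only [hQ, if_false]
      exact (hC Q).trans (le_max_left _ _)
  · -- doubling
    intro Q h2Q
    have hQ : Q ≠ 0 := ne_zero_of_two_nsmul_ne_zero h2Q
    rcases Q with _ | ⟨x, y, h⟩
    · exact absurd rfl hQ
    · have hy : y ≠ W.toAffine.negY x y := (two_nsmul_some_ne_zero_iff h).mp h2Q
      have hdup := fun v : AbsoluteValue ℚ ℝ =>
        neronLocalHeight_two_nsmul_of v (tateCorrection_bounded_of_two_ne_zero v W two_ne_zero) h h2Q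
      simp only [two_nsmul_some_eq_of_Y_ne h hy] at hdup ⊢
      rw [hg]
      simp only [WeierstrassCurve.Affine.Point.some_ne_zero, if_false, hL]
      linarith [sum_neronLocalHeight_of_duplication h hy _ hdup]
  · -- order two
    intro Q hQ h2Q
    rcases Q with _ | ⟨x, y, h⟩
    · exact absurd rfl hQ
    · have hy : y = W.toAffine.negY x y := by
        by_contra hy
        exact ((two_nsmul_some_ne_zero_iff h).mpr hy) h2Q
      rw [hg]
      simp only [WeierstrassCurve.Affine.Point.some_ne_zero, if_false, hL]
      rw [sum_neronLocalHeight_of_two_torsion h hy, mul_zero]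

end Rat

end WeierstrassCurve.Affine.Point

end
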